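import Summits.ResolutionOfSingularities.ResolutionOfSingularities.Theorems.FrobeniusClosingSteerNonRationalStepTransversalFrame
import HarnessLib

/-!
# Crux `Steer` (stmt-ResolutionOfSingularities-16345), chain W4.1, hGW3 / I″ KERNEL (K-I2) FILE E, part 2 of 2: THE TRANSVERSAL DERIVATION
# `∂ = ∂_X + (Y/X)∂_Y + (Z/X)∂_Z` OF THE CHART `B = S₀[Y/X, Z/X]` INTO `Ŝ₁`, WITH RESIDUE CONTROL (Theses-free, definition-free)

OURS (campaign `res-hironaka`, rung L ★L-G4, slot W4.1; seat res-D-pv-040 g8 on res-L0-w41-plan-1 RULING 274 (a) / 275 (c); author of the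
architecture res-L0-w41-idea-3 g12: `L/res-L0-w41-idea-3/lemmaI2k/K-I2-BLUEPRINT.md` 96e1811371a42926 §1 row E / §2 E, signature file
`K-I2_signatures.lean` 6760785230e5555e §FileE — the statement of `exists_transversal_derivation` below is that signature VERBATIM;
consumer: FILE H `…NonRationalStepNotIsolated` (I″ = `LemmaI.NonRationalStepNotIsolated d`, the `hI2` binder of stub-2's
`GeomAssembly.geomChain_false_of_pieces`); `--supports stmt-ResolutionOfSingularities-16345 --as helper`). Replaces the role of no printed item
and is NOT a statement of the manuscript under review [claim: Hironaka2017, status: under-review]; AI-produced commutative algebra over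
classical inputs (Cohen structure theorem, Matsumura §28–§30), weaker than expert review; nothing here is progress on resolution of singularities in
characteristic `p` by itself.

## Setting (the K-I2 INTERFACE CONVENTION: a derivation along `ψ : B → Ŝ₁` is a bare function with the two laws)
`S₀ ≤ S₁ ⊂ L` local subrings of a field of characteristic `2`, `S₀` regular of dimension `3` with regular system of parameters `X, Y, Z`
(`Ideal.span {X, Y, Z} = 𝔪₀`), `X ≠ 0`, the chart `B := S₀[𝔪₀/X] = S₀[Y/X, Z/X] ≤ S₁` (`blowupRing`, `LemmaI.blowupRing_eq_closure_triple`), the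
local condition `𝔪₀ ⊆ 𝔪₁`, `S₁` Noetherian, `Ŝ₁ := AdicCompletion 𝔪₁ S₁`, `ψ : B → Ŝ₁` the structure map.

## What is proved
* `exists_basic_derivations` — **Stage 1**: derivations `∂₀, ∂₁, ∂₂ : S₀ → Ŝ₁` along `ι : S₀ → S₁ → Ŝ₁` with `∂ᵢ xⱼ = δᵢⱼ` for any rsop
  `xS : Fin 3 → S₀`, and RESIDUE CONTROL `∂ᵢ c ≡ ι(s) (mod 𝔪₀Ŝ₁)`: a Cohen frame `Ŝ₀ ≅ κ⟦X₀,X₁,X₂⟧` taking `xS` to the variables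
  (`NestedFrames.exists_frame_with_section`, `constantCoeff ∘ frame = residue`), the partial derivatives `MvPowerSeries.pderiv`, the canonical
  `Ŝ₀ → Ŝ₁` (`adicCompletionMap`), `𝔪̂₀ = 𝔪₀Ŝ₀` (Mathlib `AdicCompletion.maximalIdeal_eq_map`) and `κ(S₀) ↠ κ(Ŝ₀)`.
* `eq_sum_C_mul_X_pow`, `add_le_totalDegree`, `sum_coeff_mul_pow_eq_zero` (the homogenised relation `Σ c_α Y^{α₀}Z^{α₁}X^{n−|α|} = 0` in
  `S₀` from `P(Y/X, Z/X) = 0`), **`descent_identity`** (pure algebra: if `(alg, Dp)` respects `y = x T′`, `z = x U′` letter by letter then a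
  homogenised relation forces `Dp (x^n P) = 0` — two substitutions of `R[A,B,V]`, `MvPolynomial.induction_on`).
* **`exists_transversal_derivation`** (FILE E, signature VERBATIM): `∃ ∂ : B → Ŝ₁`, additive, Leibniz along `ψ`, `∂ X = 1`, `∂ (Y/X) = ∂ (Z/X) = 0`,
  and `∀ c ∈ S₀, ∃ s₀ s₁ s₂ ∈ S₀, ∂ c − ψ(s₀ + s₁·Y/X + s₂·Z/X) ∈ 𝔪₀·Ŝ₁`. Construction: `∂ := ∂₀ + ψ(Y/X)∂₁ + ψ(Z/X)∂₂` on `S₀` (so `∂ X = 1`,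
  `∂ Y = ψ(Y/X)`, `∂ Z = ψ(Z/X)`), extended to `S₀[T′,U′]` with `∂ T′ = ∂ U′ = 0` (`MvPolynomial.exists_derivation_C_eq_X_eq`), descended to `B`
  through the surjection `T′ ↦ Y/X, U′ ↦ Z/X` by `descent_identity` and the fact that `X` is a NON-ZERO-DIVISOR of `Ŝ₁` (`Ŝ₁` is flat over the
  domain `S₁`, Mathlib `AdicCompletion.flat_of_isNoetherian` + `IsSMulRegular.of_flat`; no regularity of `S₁` is used).

[cite: Matsumura1987, Thm. 28.3 (Cohen structure theorem: coefficient fields), Thm. 30.6 (derivations of power series rings)] bears_on: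
LADDER-RESOLUTION L ★L-G4 W4.1 (crux `Steer`, hGW3 at `e ≥ 3` = WORK-MODULO {I″}; I″ kernel file E of eight).
-/

noncomputable section

set_option linter.dupNamespace false

open IsLocalRing

namespace Summit.ResolutionOfSingularities.ResolutionOfSingularities.Theorems.SwitchingDichotomy.LemmaI2

open Literature.AlgebraicGeometry.Resolution
open Summit.ResolutionOfSingularities.ResolutionOfSingularities.Theorems.SwitchingDichotomy

variable {L : Type} [Field L] [CharP L 2] {S₀ S₁ : Subring L} [IsLocalRing S₀] [IsLocalRing S₁]

/-- (E) **TRANSVERSAL DERIVATION with residue control** — signature VERBATIM from res-L0-w41-idea-3's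
`K-I2_signatures.lean` 6760785230e5555e §FileE. `∂ X = 1`, `∂ (Y/X) = ∂ (Z/X) = 0`, and on old constants `c ∈ S₀` the value
`∂ c` is, modulo `𝔪₀·Ŝ₁`, an `S₀`-combination `s₀ + s₁·(Y/X) + s₂·(Z/X)` («only residues enter»). Construction: `∂ := ∂_X + (Y/X)∂_Y + (Z/X)∂_Z`
on `S₀` (Stage 1), extended to `S₀[T′,U′]` by `∂ T′ = ∂ U′ = 0` (`MvPolynomial.exists_derivation_C_eq_X_eq`) and DESCENDED to
`B = S₀[Y/X, Z/X]` (image of `T′ ↦ Y/X, U′ ↦ Z/X`): a relation `P(Y/X, Z/X) = 0` of degree `≤ n` gives `Σ c_α Y^{α₀}Z^{α₁}X^{n−|α|} = 0` in `S₀`,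
and the two substitutions `(A,B,V) ↦ (X T′, X U′, X)`, `(A,B,V) ↦ (Y, Z, X)` of `S₀[A,B,V]` agree under `(algebraMap, ∂)` letter by letter, so
`∂(X^n P) = ∂(0) = 0`, i.e. `X^n ∂P = 0`, and `X` is a non-zero-divisor of `Ŝ₁` (flat over the domain `S₁`). OURS.
[cite: Matsumura1987, Thm. 28.3, Thm. 30.6] (folklore) -/
theorem exists_transversal_derivation (h₀₁ : S₀ ≤ S₁) (hreg₀ : IsRegularLocalRing S₀) (hdim₀ : ringKrullDim S₀ = 3)
    [IsNoetherianRing S₁] {X Y Z : S₀} (hXYZ : Ideal.span {X, Y, Z} = maximalIdeal S₀) (hX0 : (X : L) ≠ 0)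
    (hY : Y ∈ maximalIdeal S₀) (hZ : Z ∈ maximalIdeal S₀) (hB : blowupRing S₀ (X : L) ≤ S₁)
    (hdom : ∀ m : S₀, m ∈ maximalIdeal S₀ → Subring.inclusion h₀₁ m ∈ maximalIdeal S₁)
    (ψ : blowupRing S₀ (X : L) →+* AdicCompletion (maximalIdeal S₁) S₁)
    (hψ : ∀ b, ψ b = algebraMap S₁ (AdicCompletion (maximalIdeal S₁) S₁) (Subring.inclusion hB b)) :
    ∃ D : blowupRing S₀ (X : L) → AdicCompletion (maximalIdeal S₁) S₁,
      (∀ a b, D (a + b) = D a + D b) ∧ (∀ a b, D (a * b) = ψ a * D b + ψ b * D a) ∧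
      D ⟨(X : L), le_blowupRing S₀ _ X.2⟩ = 1 ∧
      D ⟨(Y : L) / (X : L), div_mem_blowupRing _ hY⟩ = 0 ∧
      D ⟨(Z : L) / (X : L), div_mem_blowupRing _ hZ⟩ = 0 ∧
      ∀ c : S₀, ∃ s₀ s₁ s₂ : S₀,
        D ⟨(c : L), le_blowupRing S₀ _ c.2⟩ -
            ψ (⟨(s₀ : L), le_blowupRing S₀ _ s₀.2⟩ + ⟨(s₁ : L), le_blowupRing S₀ _ s₁.2⟩ * ⟨(Y : L) / (X : L), div_mem_blowupRing _ hY⟩ +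
                ⟨(s₂ : L), le_blowupRing S₀ _ s₂.2⟩ * ⟨(Z : L) / (X : L), div_mem_blowupRing _ hZ⟩) ∈
          Ideal.map (ψ.comp (Subring.inclusion (le_blowupRing S₀ (X : L)))) (maximalIdeal S₀) := by
  classical
  -- names
  let XB : (blowupRing S₀ (X : L)) := ⟨(X : L), le_blowupRing S₀ _ X.2⟩
  let tB : (blowupRing S₀ (X : L)) := ⟨(Y : L) / (X : L), div_mem_blowupRing _ hY⟩
  let uB : (blowupRing S₀ (X : L)) := ⟨(Z : L) / (X : L), div_mem_blowupRing _ hZ⟩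
  let incl : S₀ →+* (blowupRing S₀ (X : L)) := Subring.inclusion (le_blowupRing S₀ (X : L))
  let ι : S₀ →+* (AdicCompletion (maximalIdeal S₁) S₁) := (algebraMap S₁ (AdicCompletion (maximalIdeal S₁) S₁)).comp (Subring.inclusion h₀₁)
  have hψincl : ∀ c : S₀, ψ (incl c) = ι c := fun c => by rw [hψ]; rfl
  have hψcomp : ψ.comp incl = ι := RingHom.ext hψincl
  -- Stage 1 with the rsop `![X, Y, Z]`
  have hxS : Ideal.span (Set.range ![X, Y, Z]) = maximalIdeal S₀ := by
    rw [← hXYZ]; congr 1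
    ext w
    simp only [Matrix.range_cons, Matrix.range_empty, Set.union_empty, Set.union_singleton, Set.mem_union,
      Set.mem_insert_iff, Set.mem_singleton_iff]
    tauto
  obtain ⟨D3, hadd, hmul, hval, hres⟩ := exists_basic_derivations h₀₁ hreg₀ hdim₀ ![X, Y, Z] hxS hdom
  have hvalX : D3 0 X = 1 ∧ D3 1 X = 0 ∧ D3 2 X = 0 :=
    ⟨by simpa using hval 0 0, by simpa using hval 1 0, by simpa using hval 2 0⟩
  have hvalY : D3 0 Y = 0 ∧ D3 1 Y = 1 ∧ D3 2 Y = 0 :=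
    ⟨by simpa using hval 0 1, by simpa using hval 1 1, by simpa using hval 2 1⟩
  have hvalZ : D3 0 Z = 0 ∧ D3 1 Z = 0 ∧ D3 2 Z = 1 :=
    ⟨by simpa using hval 0 2, by simpa using hval 1 2, by simpa using hval 2 2⟩
  -- the coefficient derivation `∂ = ∂_X + t ∂_Y + u ∂_Z : S₀ → Ŝ₁` (module structure through `ι`)
  letI algι : Algebra S₀ (AdicCompletion (maximalIdeal S₁) S₁) := ι.toAlgebra
  have hsmul : ∀ (a : S₀) (m : (AdicCompletion (maximalIdeal S₁) S₁)), a • m = ι a * m := fun a m => Algebra.smul_def a m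
  let dfun : S₀ → (AdicCompletion (maximalIdeal S₁) S₁) := fun c => D3 0 c + ψ tB * D3 1 c + ψ uB * D3 2 c
  have hdfun_add : ∀ a b, dfun (a + b) = dfun a + dfun b := fun a b => by
    simp only [dfun, hadd]; ring
  let Dcoef : Derivation ℤ S₀ (AdicCompletion (maximalIdeal S₁) S₁) := Derivation.mk' (AddMonoidHom.toIntLinearMap (AddMonoidHom.mk' dfun hdfun_add))
    (fun a b => by
      change dfun (a * b) = a • dfun b + b • dfun a
      rw [hsmul, hsmul]
      simp only [dfun, hmul]
      change ι a * D3 0 b + ι b * D3 0 a + ψ tB * (ι a * D3 1 b + ι b * D3 1 a) + ψ uB * (ι a * D3 2 b + ι b * D3 2 a) = _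
      ring)
  have hDcoef : ∀ c, Dcoef c = D3 0 c + ψ tB * D3 1 c + ψ uB * D3 2 c := fun _ => rfl
  have hDcoefX : Dcoef X = 1 := by rw [hDcoef, hvalX.1, hvalX.2.1, hvalX.2.2]; ring
  have hDcoefY : Dcoef Y = ψ tB := by rw [hDcoef, hvalY.1, hvalY.2.1, hvalY.2.2]; ring
  have hDcoefZ : Dcoef Z = ψ uB := by rw [hDcoef, hvalZ.1, hvalZ.2.1, hvalZ.2.2]; ring
  -- `Ŝ₁` as an `S₀[T′,U′]`-algebra through `T′ ↦ ψ t, U′ ↦ ψ u`; the derivation `Dp` with `Dp T′ = Dp U′ = 0`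
  let alg : MvPolynomial (Fin 2) S₀ →+* (AdicCompletion (maximalIdeal S₁) S₁) := MvPolynomial.eval₂Hom ι ![ψ tB, ψ uB]
  letI algP : Algebra (MvPolynomial (Fin 2) S₀) (AdicCompletion (maximalIdeal S₁) S₁) := alg.toAlgebra
  have halgdef : ∀ P, algebraMap (MvPolynomial (Fin 2) S₀) (AdicCompletion (maximalIdeal S₁) S₁) P = alg P := fun _ => rfl
  haveI : IsScalarTower S₀ (MvPolynomial (Fin 2) S₀) (AdicCompletion (maximalIdeal S₁) S₁) := IsScalarTower.of_algebraMap_eq fun c => by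
    rw [halgdef, MvPolynomial.algebraMap_eq]
    exact (MvPolynomial.eval₂Hom_C _ _ c).symm
  obtain ⟨Dp, hDpC, hDpX⟩ := MvPolynomial.exists_derivation_C_eq_X_eq (σ := Fin 2) Dcoef (fun _ : Fin 2 => (0 : (AdicCompletion (maximalIdeal S₁) S₁)))
  have hsmulP : ∀ (P : MvPolynomial (Fin 2) S₀) (m : (AdicCompletion (maximalIdeal S₁) S₁)), P • m = alg P * m := fun P m => Algebra.smul_def P m
  -- the chart presentation `evB : S₀[T′,U′] → B`, `algebraMap = ψ ∘ evB`, surjectivity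
  let evB : MvPolynomial (Fin 2) S₀ →+* (blowupRing S₀ (X : L)) := MvPolynomial.eval₂Hom incl ![tB, uB]
  have halg : ∀ P, alg P = ψ (evB P) := by
    intro P
    change alg P = (ψ.comp evB) P
    congr 1
    refine MvPolynomial.ringHom_ext (fun c => ?_) (fun i => ?_)
    · change MvPolynomial.eval₂Hom ι _ (MvPolynomial.C c) = ψ (MvPolynomial.eval₂Hom incl _ (MvPolynomial.C c))
      rw [MvPolynomial.eval₂Hom_C, MvPolynomial.eval₂Hom_C, hψincl]
    · change MvPolynomial.eval₂Hom ι _ (MvPolynomial.X i) = ψ (MvPolynomial.eval₂Hom incl _ (MvPolynomial.X i))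
      rw [MvPolynomial.eval₂Hom_X', MvPolynomial.eval₂Hom_X']
      fin_cases i <;> rfl
  have hsurj : ∀ b : (blowupRing S₀ (X : L)), ∃ P, evB P = b := by
    suffices h : ∀ w ∈ (blowupRing S₀ (X : L)), ∃ P, ((evB P : (blowupRing S₀ (X : L))) : L) = w by
      intro b; obtain ⟨P, hP⟩ := h b b.2; exact ⟨P, Subtype.ext hP⟩
    intro w hw
    rw [LemmaI.blowupRing_eq_closure_triple hXYZ hX0] at hw
    induction hw using Subring.closure_induction with
    | mem v hv =>
      rcases hv with hv | hv
      · refine ⟨MvPolynomial.C ⟨v, hv⟩, ?_⟩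
        change ((MvPolynomial.eval₂Hom incl _ (MvPolynomial.C _) : (blowupRing S₀ (X : L))) : L) = v
        rw [MvPolynomial.eval₂Hom_C]; rfl
      · rcases hv with rfl | rfl
        · refine ⟨MvPolynomial.X 0, ?_⟩
          change ((MvPolynomial.eval₂Hom incl _ (MvPolynomial.X 0) : (blowupRing S₀ (X : L))) : L) = _
          rw [MvPolynomial.eval₂Hom_X']; rfl
        · refine ⟨MvPolynomial.X 1, ?_⟩
          change ((MvPolynomial.eval₂Hom incl _ (MvPolynomial.X 1) : (blowupRing S₀ (X : L))) : L) = _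
          rw [MvPolynomial.eval₂Hom_X']; rfl
    | zero => exact ⟨0, by rw [map_zero]; rfl⟩
    | one => exact ⟨1, by rw [map_one]; rfl⟩
    | add a b _ _ ha hb =>
      obtain ⟨P, hP⟩ := ha; obtain ⟨Q, hQ⟩ := hb
      exact ⟨P + Q, by rw [map_add, Subring.coe_add, hP, hQ]⟩
    | neg a _ ha =>
      obtain ⟨P, hP⟩ := ha
      exact ⟨-P, by rw [map_neg, Subring.coe_neg, hP]⟩
    | mul a b _ _ ha hb =>
      obtain ⟨P, hP⟩ := ha; obtain ⟨Q, hQ⟩ := hb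
      exact ⟨P * Q, by rw [map_mul, Subring.coe_mul, hP, hQ]⟩
  -- basic values of `Dp` and `alg`
  have hDpCX : Dp (MvPolynomial.C X) = 1 := by rw [hDpC, hDcoefX]
  have hDpCY : Dp (MvPolynomial.C Y) = ψ tB := by rw [hDpC, hDcoefY]
  have hDpCZ : Dp (MvPolynomial.C Z) = ψ uB := by rw [hDpC, hDcoefZ]
  have halgC : ∀ c : S₀, alg (MvPolynomial.C c) = ι c := fun c => MvPolynomial.eval₂Hom_C _ _ c
  have halgX0 : alg (MvPolynomial.X 0) = ψ tB := MvPolynomial.eval₂Hom_X' _ _ 0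
  have halgX1 : alg (MvPolynomial.X 1) = ψ uB := MvPolynomial.eval₂Hom_X' _ _ 1
  have hιX : ι X = ψ XB := (hψincl X).symm
  have hιY : ι Y = ψ XB * ψ tB := by
    rw [← map_mul, ← hψincl]; congr 1
    exact Subtype.ext (by change (Y : L) = X * (Y / X); rw [mul_div_cancel₀ _ hX0])
  have hιZ : ι Z = ψ XB * ψ uB := by
    rw [← map_mul, ← hψincl]; congr 1
    exact Subtype.ext (by change (Z : L) = X * (Z / X); rw [mul_div_cancel₀ _ hX0])
  -- Leibniz for `Dp` in product form
  have hDpmul : ∀ P Q, Dp (P * Q) = alg P * Dp Q + alg Q * Dp P := fun P Q => by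
    rw [Derivation.leibniz, hsmulP, hsmulP]
  -- DESCENT: a relation `evB P = 0` forces `Dp P = 0`
  have hcompL : MvPolynomial.eval₂Hom S₀.subtype ![(Y : L) / X, (Z : L) / X] = (blowupRing S₀ (X : L)).subtype.comp evB := by
    refine MvPolynomial.ringHom_ext (fun c => ?_) (fun i => ?_)
    · rw [MvPolynomial.eval₂Hom_C, RingHom.comp_apply]
      change _ = ((MvPolynomial.eval₂Hom incl _ (MvPolynomial.C c) : (blowupRing S₀ (X : L))) : L)
      rw [MvPolynomial.eval₂Hom_C]; rfl
    · rw [MvPolynomial.eval₂Hom_X', RingHom.comp_apply]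
      change _ = ((MvPolynomial.eval₂Hom incl _ (MvPolynomial.X i) : (blowupRing S₀ (X : L))) : L)
      rw [MvPolynomial.eval₂Hom_X']
      fin_cases i <;> rfl
  have hX1 : (Subring.inclusion h₀₁ X : S₁) ≠ 0 := fun e => hX0 (by simpa using congrArg Subtype.val e)
  have hker : ∀ P : MvPolynomial (Fin 2) S₀, evB P = 0 → Dp P = 0 := by
    intro P hP0
    have hR0 := sum_coeff_mul_pow_eq_zero (Y := Y) (Z := Z) hX0 P le_rfl
      (by rw [hcompL, RingHom.comp_apply, hP0]; rfl)
    have h1 := descent_identity alg Dp (fun P Q => map_add Dp P Q) hDpmul (hDpX 0) (hDpX 1)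
      (by rw [hDpCY, hDpCX, halgX0, mul_one]) (by rw [hDpCZ, hDpCX, halgX1, mul_one])
      (by rw [halgC, halgC, halgX0, hιY, hιX]) (by rw [halgC, halgC, halgX1, hιZ, hιX]) P le_rfl hR0
    rw [hDpmul, halg P, hP0, map_zero, zero_mul, add_zero, map_pow, halgC] at h1
    -- `ι X` is a non-zero-divisor of `Ŝ₁` (flat over the domain `S₁`)
    have hregX : IsSMulRegular (AdicCompletion (maximalIdeal S₁) S₁) (ι X ^ P.totalDegree) := by
      have h0 : IsSMulRegular S₁ (Subring.inclusion h₀₁ X ^ P.totalDegree) :=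
        (IsRegular.of_ne_zero (pow_ne_zero _ hX1)).left.isSMulRegular
      have := h0.of_flat (S := (AdicCompletion (maximalIdeal S₁) S₁))
      rwa [map_pow] at this
    have h2 : ι X ^ P.totalDegree • Dp P = ι X ^ P.totalDegree • (0 : (AdicCompletion (maximalIdeal S₁) S₁)) := by
      rw [smul_eq_mul, smul_eq_mul, mul_zero]; exact h1
    exact hregX h2
  -- the derivation on `B`: `D b := Dp P` for any `P` with `evB P = b`
  have hwd : ∀ P Q, evB P = evB Q → Dp P = Dp Q := fun P Q h => by
    have := hker (P - Q) (by rw [map_sub evB, h, sub_self])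
    rwa [map_sub Dp, sub_eq_zero] at this
  let D : (blowupRing S₀ (X : L)) → (AdicCompletion (maximalIdeal S₁) S₁) := fun b => Dp (Classical.choose (hsurj b))
  have hD : ∀ P, D (evB P) = Dp P := fun P => by
    change Dp (Classical.choose (hsurj (evB P))) = Dp P
    exact hwd _ _ (Classical.choose_spec (hsurj (evB P)))
  have hevC : ∀ c : S₀, evB (MvPolynomial.C c) = incl c := fun c => MvPolynomial.eval₂Hom_C _ _ c
  have hev0 : evB (MvPolynomial.X 0) = tB := MvPolynomial.eval₂Hom_X' _ _ 0
  have hev1 : evB (MvPolynomial.X 1) = uB := MvPolynomial.eval₂Hom_X' _ _ 1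
  refine ⟨D, fun a b => ?_, fun a b => ?_, ?_, ?_, ?_, fun c => ?_⟩
  · obtain ⟨P, rfl⟩ := hsurj a; obtain ⟨Q, rfl⟩ := hsurj b
    rw [← map_add evB, hD, hD, hD, map_add Dp]
  · obtain ⟨P, rfl⟩ := hsurj a; obtain ⟨Q, rfl⟩ := hsurj b
    rw [← map_mul evB, hD, hD, hD, hDpmul, halg, halg]
  · change D XB = 1
    rw [show XB = evB (MvPolynomial.C X) from (hevC X).symm, hD, hDpCX]
  · change D tB = 0
    rw [← hev0, hD, hDpX]
  · change D uB = 0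
    rw [← hev1, hD, hDpX]
  · obtain ⟨s₀, hs₀⟩ := hres 0 c
    obtain ⟨s₁, hs₁⟩ := hres 1 c
    obtain ⟨s₂, hs₂⟩ := hres 2 c
    refine ⟨s₀, s₁, s₂, ?_⟩
    rw [hψcomp]
    have hDc : D ⟨(c : L), le_blowupRing S₀ _ c.2⟩ = D3 0 c + ψ tB * D3 1 c + ψ uB * D3 2 c := by
      rw [show (⟨(c : L), le_blowupRing S₀ _ c.2⟩ : blowupRing S₀ (X : L)) = evB (MvPolynomial.C c) from (hevC c).symm,
        hD, hDpC, hDcoef]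
    rw [hDc, map_add, map_add, map_mul, map_mul]
    change D3 0 c + ψ tB * D3 1 c + ψ uB * D3 2 c - (ψ (incl s₀) + ψ (incl s₁) * ψ tB + ψ (incl s₂) * ψ uB) ∈ _
    rw [hψincl, hψincl, hψincl]
    have : D3 0 c + ψ tB * D3 1 c + ψ uB * D3 2 c - (ι s₀ + ι s₁ * ψ tB + ι s₂ * ψ uB) =
        (D3 0 c - ι s₀) + ψ tB * (D3 1 c - ι s₁) + ψ uB * (D3 2 c - ι s₂) := by ring
    rw [this]
    exact Ideal.add_mem _ (Ideal.add_mem _ hs₀ (Ideal.mul_mem_left _ _ hs₁)) (Ideal.mul_mem_left _ _ hs₂)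

end Summit.ResolutionOfSingularities.ResolutionOfSingularities.Theorems.SwitchingDichotomy.LemmaI2

end
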